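import Literature.AlgebraicGeometry.Resolution.OstrowskiRamification
import Literature.AlgebraicGeometry.Resolution.SubfieldTransport
import Mathlib.FieldTheory.PrimitiveElement
import Mathlib.FieldTheory.PurelyInseparable.Basic
import Mathlib.RingTheory.Norm.Transitivity
import HarnessLib

/-!
# Ostrowski's lemma II: the prime divisors of `e` and `f` over a henselian field

Topic: `Literature/AlgebraicGeometry/Resolution` (valued function fields). Second file of the
discharge of the named fact `Kuhlmann2010OstrowskiLemma` (the Lemma of Ostrowski,
F.-V. Kuhlmann, Trans. AMS 362 (2010) = arXiv:1003.5678, §2.3 (9):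
`[L:K] = (vL:vK)·[Lv:Kv]·p^ν` when the extension of `v` from `K` to `L` is unique). For a
FINITE extension `F ≤ S` of subfields of the ambient valued field `(Ω, V)` (`Ω` algebraically
closed) over a HENSELIAN `F` we prove:

  **every prime divisor of `e(S|F)` and every prime divisor of `f(S|F)` divides `[S : F]`.**

For `e`: the norm of `x ∈ S` is a product of `[S : F]` conjugates of `x`, all of the same value
over a henselian field (`IsHenselianField.valuation_algHom_apply`), so `[S:F]·v(x) ∈ vF` and the
finite group `vS/vF` has exponent dividing `[S : F]`. For `f`: the residue `ȳ` of `y ∈ V ∩ S`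
has degree over `Fv` DIVIDING `[F(y) : F]` — the reduction of the minimal polynomial `μ` of `y`
is a power of the minimal polynomial `g` of `ȳ`, because every root of `μ` is an `F`-conjugate
`φ(y)` of `y`, and `φ` maps the maximal ideal into itself (henselian!), so that a lift `γ` of
`g` with `γ(y) ∈ 𝔪` has `γ(φ y) = φ(γ(y)) ∈ 𝔪` —; and a finite extension all of whose elements
have degree dividing `m` has degree whose prime divisors divide `m` (primitive element for the
separable part; an inseparable element has degree divisible by `p`). This is the arithmetic
behind Zariski–Samuel II, Ch. VI §12, (23) and Thm. 25 ("the order `e'₀` of `G_T/G_V` is prime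
to `π`"), in a form that needs no ramification groups.

## Content (everything PROVED)

* `exists_eq_pow_of_forall_mem_roots` — a monic `P ∈ K[X]` splitting in `E` all of whose roots
  are roots of the irreducible monic `g` is a power of `g`. [folklore]
* `prime_dvd_of_dvd_finrank_of_natDegree_minpoly_dvd` — if every element of the finite
  extension `E|A` has degree dividing `m`, every prime divisor of `[E : A]` divides `m`.
* `not_dvd_index_of_forall_pow_mem` — a subgroup `H` of a commutative group with `g^m ∈ H` for
  all `g` has index prime to every prime `q ∤ m`.
* `exists_valuation_pow_finrank_eq` — `F` henselian, `S ≥ F` finite: `v(x)^[S:F] ∈ vF`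
  (`Algebra.norm_eq_prod_roots`). `dvd_relFinrank_of_prime_dvd_relRamificationIndex` — prime
  divisors of `e(S|F)` divide `[S : F]`.
* `natDegree_minpoly_residue_dvd` — **the key lemma**: for `F` henselian and `y ∈ V` integral
  over `F`, `deg_{Fv}(ȳ) ∣ deg_F(y)`. `dvd_relFinrank_of_prime_dvd_relInertiaDegree` — prime
  divisors of `f(S|F)` divide `[S : F]`; `dvd_relFinrank_of_prime_dvd` — both together.

## Sources

* F.-V. Kuhlmann, Trans. AMS 362 (2010) = arXiv:1003.5678, §1.1, §2.3 (9). [Kuhlmann2010]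
* O. Zariski, P. Samuel, *Commutative Algebra* II (1960), Ch. VI §12, (20)–(23), Thm. 25 and
  Corollary (PDF pp. 99–101). [ZariskiSamuel1960]

No definitions.
-/

noncomputable section

open IsLocalRing Polynomial
open scoped IntermediateField

namespace Literature.AlgebraicGeometry.Resolution

universe u

/-! ### Three context-free lemmas -/

section Pure

/-- A monic polynomial `P ∈ K[X]` which splits in the extension `E` and all of whose roots in
`E` are roots of the monic irreducible `g ∈ K[X]` is a power of `g` (induction on the degree:
a root `a` of `P` has minimal polynomial `g`, so `g ∣ P`, and `P/g` again qualifies).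
[folklore] -/
theorem exists_eq_pow_of_forall_mem_roots {K E : Type*} [Field K] [Field E] [Algebra K E]
    {g : K[X]} (hg : Irreducible g) (hgm : g.Monic) :
    ∀ (n : ℕ) (P : K[X]), P.natDegree = n → P.Monic → (P.map (algebraMap K E)).Splits →
      (∀ a ∈ (P.map (algebraMap K E)).roots, aeval a g = 0) → ∃ j : ℕ, P = g ^ j := by
  intro n
  induction n using Nat.strong_induction_on with
  | _ n ih =>
  intro P hn hPm hPs hroots
  by_cases hn0 : n = 0
  · refine ⟨0, ?_⟩
    rw [pow_zero]
    exact Polynomial.eq_one_of_monic_natDegree_zero hPm (hn ▸ hn0)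
  -- a root `a` of `P` in `E`
  have hdeg : (P.map (algebraMap K E)).degree ≠ 0 := by
    rw [degree_map, degree_eq_natDegree hPm.ne_zero, hn]
    exact_mod_cast hn0
  obtain ⟨a, ha⟩ := hPs.exists_eval_eq_zero hdeg
  have hPa : aeval a P = 0 := by rwa [aeval_def, ← eval_map]
  have hP0 : P.map (algebraMap K E) ≠ 0 := (hPm.map _).ne_zero
  have haroot : a ∈ (P.map (algebraMap K E)).roots := by
    rw [mem_roots hP0, IsRoot.def]
    exact ha
  have hga : aeval a g = 0 := hroots a haroot
  have hgmin : g = minpoly K a := minpoly.eq_of_irreducible_of_monic hg hga hgm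
  have hgdvd : g ∣ P := hgmin ▸ minpoly.dvd K a hPa
  obtain ⟨P₁, hP₁⟩ := hgdvd
  have hP₁m : P₁.Monic := by
    have : (g * P₁).Monic := hP₁ ▸ hPm
    exact hgm.of_mul_monic_left this
  have hgdeg : 0 < g.natDegree := by
    have haint : IsIntegral K a := ⟨P, hPm, hPa⟩
    rw [hgmin]
    exact minpoly.natDegree_pos haint
  have hP₁deg : P₁.natDegree < n := by
    have := congrArg natDegree hP₁
    rw [hgm.natDegree_mul hP₁m, hn] at this
    omega
  have hP₁s : (P₁.map (algebraMap K E)).Splits := by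
    refine hPs.of_dvd hP0 ?_
    rw [hP₁, Polynomial.map_mul]
    exact dvd_mul_left _ _
  have hP₁roots : ∀ b ∈ (P₁.map (algebraMap K E)).roots, aeval b g = 0 := by
    intro b hb
    refine hroots b ?_
    have hle : (P₁.map (algebraMap K E)).roots ≤ (P.map (algebraMap K E)).roots := by
      refine Polynomial.roots.le_of_dvd hP0 ?_
      rw [hP₁, Polynomial.map_mul]
      exact dvd_mul_left _ _
    exact Multiset.mem_of_le hle hb
  obtain ⟨j, hj⟩ := ih P₁.natDegree hP₁deg P₁ rfl hP₁m hP₁s hP₁roots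
  exact ⟨j + 1, by rw [hP₁, hj, pow_succ']⟩

/-- **Prime divisors of a degree through the degrees of elements.** If `E|A` is a finite
extension of fields every element of which has degree (of its minimal polynomial) dividing
`m`, then every prime divisor `q` of `[E : A]` divides `m`: with `E_s` the separable closure of
`A` in `E`, `[E_s : A]` is the degree of a primitive element, and `[E : E_s] = p^n` with
`n ≥ 1` only if some element of `E` is inseparable over `A`, whose degree is then divisible by
`p`. [folklore] -/
theorem prime_dvd_of_dvd_finrank_of_natDegree_minpoly_dvd {A E : Type*} [Field A]
    [Field E] [Algebra A E] [FiniteDimensional A E] {m q : ℕ} (hq : q.Prime)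
    (hm : ∀ x : E, (minpoly A x).natDegree ∣ m) (hdvd : q ∣ Module.finrank A E) : q ∣ m := by
  set p := ringExpChar A with hp
  let Es : IntermediateField A E := separableClosure A E
  haveI : ExpChar Es p := expChar_of_injective_algebraMap (algebraMap A Es).injective p
  haveI : IsPurelyInseparable Es E := separableClosure.isPurelyInseparable A E
  have htower : Module.finrank A Es * Module.finrank Es E = Module.finrank A E :=
    Module.finrank_mul_finrank A Es E
  obtain ⟨n, hn⟩ := IsPurelyInseparable.finrank_eq_pow (F := Es) E p
  -- the separable part: a primitive element
  have hsep : Module.finrank A Es ∣ m := by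
    obtain ⟨α, hα⟩ := Field.exists_primitive_element A Es
    have hint : IsIntegral A α := Algebra.IsIntegral.isIntegral α
    have h1 : Module.finrank A A⟮α⟯ = (minpoly A α).natDegree := IntermediateField.adjoin.finrank hint
    rw [hα, IntermediateField.finrank_top'] at h1
    rw [h1, ← minpoly.algebraMap_eq (algebraMap Es E).injective α]
    exact hm _
  rw [← htower, hn] at hdvd
  rcases (Nat.Prime.dvd_mul hq).mp hdvd with h | h
  · exact h.trans hsep
  · -- `q ∣ p^n`: then `q = p` is the characteristic and `n ≥ 1`
    have hqp : q ∣ p := hq.dvd_of_dvd_pow h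
    by_cases hn0 : n = 0
    · rw [hn0, pow_zero, Nat.dvd_one] at h
      exact absurd h hq.one_lt.ne'
    rcases expChar_is_prime_or_one A p with hpp | hp1
    · have hqp' : q = p := (Nat.prime_dvd_prime_iff_eq hq hpp).mp hqp
      -- an inseparable element
      have hEs : Es ≠ ⊤ := by
        intro htop
        have h1 : Module.finrank Es E = 1 := by
          rw [htop]
          exact IntermediateField.finrank_top
        rw [h1] at hn
        exact hn0 (Nat.pow_right_injective hpp.two_le
          (show p ^ n = p ^ 0 by rw [pow_zero]; exact hn.symm))
      obtain ⟨x, hx⟩ : ∃ x : E, x ∉ Es := by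
        by_contra hall
        push Not at hall
        exact hEs (eq_top_iff.mpr fun x _ => hall x)
      have hxs : ¬ (minpoly A x).Separable := fun hs => hx (mem_separableClosure_iff.mpr hs)
      have hirr : Irreducible (minpoly A x) := minpoly.irreducible (Algebra.IsIntegral.isIntegral x)
      obtain ⟨g, hgs, k, hgk⟩ := hirr.hasSeparableContraction p
      have hk0 : k ≠ 0 := by
        rintro rfl
        rw [pow_zero, expand_one] at hgk
        exact hxs (hgk ▸ hgs)
      have hdeg : (minpoly A x).natDegree = g.natDegree * p ^ k := by
        rw [← hgk, natDegree_expand]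
      have hpd : p ∣ (minpoly A x).natDegree := by
        rw [hdeg]
        exact Dvd.dvd.mul_left (dvd_pow_self p hk0) _
      rw [hqp']
      exact hpd.trans (hm x)
    · rw [hp1, Nat.dvd_one] at hqp
      exact absurd hqp hq.one_lt.ne'

/-- For subfields `A ≤ B` of a field `K`, `B` an `A`-algebra by inclusion, `A → B → K` is a
scalar tower. (Stated once for abstract subfields: the kernel check of the defining `rfl` is
cheap here and is not repeated at the concrete residue subfields below.) [folklore] -/
theorem isScalarTower_inclusion {K : Type*} [Field K] {A B : Subfield K} (h : A ≤ B) :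
    letI : Algebra A B := (Subfield.inclusion h).toAlgebra
    IsScalarTower A B K :=
  letI : Algebra A B := (Subfield.inclusion h).toAlgebra
  IsScalarTower.of_algebraMap_eq fun _ => rfl

/-- In a commutative group, a subgroup `H` containing all `m`-th powers has index prime to
every prime `q ∤ m` (an element of order `q` in `G/H`, which has exponent dividing `m`, would
give `q ∣ m`). [folklore] -/
theorem not_dvd_index_of_forall_pow_mem {G : Type*} [CommGroup G] (H : Subgroup G)
    [H.FiniteIndex] {m q : ℕ} (hq : q.Prime) (hqm : ¬ q ∣ m) (hpow : ∀ g : G, g ^ m ∈ H) :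
    ¬ q ∣ H.index := by
  intro hdvd
  haveI : Fact q.Prime := ⟨hq⟩
  rw [Subgroup.index_eq_card] at hdvd
  obtain ⟨x, hx⟩ := exists_prime_orderOf_dvd_card' q hdvd
  obtain ⟨g, rfl⟩ := QuotientGroup.mk_surjective x
  have h1 : ((g : G ⧸ H)) ^ m = 1 := by
    rw [← QuotientGroup.mk_pow, QuotientGroup.eq_one_iff]
    exact hpow g
  have h2 : orderOf (g : G ⧸ H) ∣ m := orderOf_dvd_of_pow_eq_one h1
  rw [hx] at h2
  exact hqm h2

end Pure

/-! ### `e`: the exponent of `vS/vF` divides `[S : F]` -/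

section Ramification

variable {Ω : Type u} [Field Ω] [IsAlgClosed Ω] (V : ValuationSubring Ω) {F S : Subfield Ω}

/-- **`[S:F]·v(x) ∈ vF` over a henselian `F`**: for `(F, V ∩ F)` henselian, `S ≥ F` finite
and `x ∈ S`, `x ≠ 0`, there is `b ∈ F`, `b ≠ 0`, with `v(x)^[S:F] = v(b)` — namely the norm
`b = N_{S|F}(x)`, a product of `[S : F]` conjugates of `x` in `Ω`
(`Algebra.norm_eq_prod_roots`), all of value `v(x)` (`IsHenselianField.valuation_algHom_apply`).
[folklore] -/
theorem exists_valuation_pow_finrank_eq (h : F ≤ S)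
    (hF : IsHenselianField F (V.comap (algebraMap F Ω))) (hfin : RelFinite F S h)
    (x : S) (hx : x ≠ 0) :
    ∃ b : F, b ≠ 0 ∧ V.valuation (x : Ω) ^ relFinrank F S h = V.valuation (b : Ω) := by
  letI : Algebra F S := (Subfield.inclusion h).toAlgebra
  haveI : IsScalarTower F S Ω := IsScalarTower.of_algebraMap_eq fun _ => rfl
  haveI : FiniteDimensional F S := hfin
  have hint : IsIntegral F x := Algebra.IsIntegral.isIntegral x
  refine ⟨Algebra.norm F x, Algebra.norm_ne_zero_iff.mpr hx, ?_⟩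
  have hsplit : ((minpoly F x).map (algebraMap F Ω)).Splits := IsAlgClosed.splits _
  have hnorm := Algebra.norm_eq_prod_roots (L := S) (F := Ω) (x := x) hsplit
  -- every root has value `v(x)`
  haveI : IsScalarTower F F⟮x⟯ Ω := IsScalarTower.of_algebraMap_eq fun _ => rfl
  haveI : FiniteDimensional F F⟮x⟯ := IntermediateField.adjoin.finiteDimensional hint
  have hval : ∀ r ∈ (minpoly F x).aroots Ω, V.valuation r = V.valuation (x : Ω) := by
    intro r hr
    let φ : F⟮x⟯ →ₐ[F] Ω := (IntermediateField.algHomAdjoinIntegralEquiv F hint).symm ⟨r, hr⟩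
    have hφ : φ (IntermediateField.AdjoinSimple.gen F x) = r :=
      IntermediateField.algHomAdjoinIntegralEquiv_symm_apply_gen F hint ⟨r, hr⟩
    rw [← hφ, hF.valuation_algHom_apply V φ]
    rfl
  -- hence `v(N(x)) = v(x)^[S:F]`
  have hcard : ((minpoly F x).aroots Ω).card = (minpoly F x).natDegree := by
    rw [aroots_def, ← hsplit.natDegree_eq_card_roots, natDegree_map]
  have hprod : V.valuation ((minpoly F x).aroots Ω).prod =
      V.valuation (x : Ω) ^ (minpoly F x).natDegree := by
    rw [map_multiset_prod, Multiset.map_congr rfl hval, Multiset.map_const', Multiset.prod_replicate,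
      hcard]
  have hdeg : (minpoly F x).natDegree * Module.finrank F⟮x⟯ S = relFinrank F S h := by
    rw [← IntermediateField.adjoin.finrank hint]
    exact Module.finrank_mul_finrank F F⟮x⟯ S
  calc V.valuation (x : Ω) ^ relFinrank F S h
      = (V.valuation (x : Ω) ^ (minpoly F x).natDegree) ^ Module.finrank F⟮x⟯ S := by
        rw [← pow_mul, hdeg]
    _ = V.valuation (algebraMap F Ω (Algebra.norm F x)) := by
        rw [hnorm, map_pow, hprod]
    _ = V.valuation ((Algebra.norm F x : F) : Ω) := rfl

/-- **Prime divisors of `e(S|F)` divide `[S : F]`** for `F` henselian and `S ≥ F` finite: the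
finite group `vS/vF` is killed by `[S : F]` (`exists_valuation_pow_finrank_eq`), so its order
is prime to every prime not dividing `[S : F]`. (ZS VI §12: `e₀` is the order of a group of
exponent prime to `π`; here relative to `[S:F]`.) [folklore] -/
theorem dvd_relFinrank_of_prime_dvd_relRamificationIndex (h : F ≤ S)
    (hF : IsHenselianField F (V.comap (algebraMap F Ω))) (hfin : RelFinite F S h)
    {q : ℕ} (hq : q.Prime) (hdvd : q ∣ relRamificationIndex V F S h) : q ∣ relFinrank F S h := by
  letI : Algebra F S := (Subfield.inclusion h).toAlgebra
  haveI : IsScalarTower F S Ω := IsScalarTower.of_algebraMap_eq fun _ => rfl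
  haveI : FiniteDimensional F S := hfin
  set W : ValuationSubring S := V.comap (algebraMap S Ω) with hW
  haveI : (valueSubgroup F W).FiniteIndex := (ramificationIndex_mul_inertiaDegree_le_finrank F W).1
  by_contra hqm
  refine not_dvd_index_of_forall_pow_mem (valueSubgroup F W) hq hqm (fun γ => ?_) hdvd
  -- `γ = v(x)`, and `γ^[S:F] = v(b)` with `b ∈ F`
  obtain ⟨x, hx⟩ := W.valuation_surjective (γ : W.ValueGroup)
  have hx0 : x ≠ 0 := fun h0 => by
    rw [h0, map_zero] at hx
    exact γ.ne_zero hx.symm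
  obtain ⟨b, hb0, hb⟩ := exists_valuation_pow_finrank_eq V h hF hfin x hx0
  have hbW : W.valuation (x ^ relFinrank F S h) = W.valuation (algebraMap F S b) := by
    refine (valuation_map_eq_iff (algebraMap S Ω) (V := W) (V' := V) rfl _ _).mp ?_
    rw [map_pow, map_pow]
    exact hb
  refine (mem_valueSubgroup_iff F W _).mpr ⟨b, hb0, ?_⟩
  rw [Units.val_pow_eq_pow_val, ← hx, ← map_pow, hbW]

end Ramification

/-! ### `f`: the degree of a residue divides the degree -/

section Residue

variable {Ω : Type u} [Field Ω] [IsAlgClosed Ω] (V : ValuationSubring Ω) {F : Subfield Ω}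

/-- **The key lemma: the degree of the residue divides the degree.** Let `(F, V ∩ F)` be
henselian, `y ∈ V` integral over `F` with minimal polynomial `μ` (degree `d`), and let `g` be
the minimal polynomial of the residue `ȳ` over the residue field `Fv ⊆ Ω̄v`. Then
`deg g ∣ d`. Proof: all `Ω`-roots of `μ` are `F`-conjugates `φ(y)` of `y`, hence lie in `V`
(`IsHenselianField.mem_iff_of_algHom`), so `μ` has coefficients in `V ∩ F` and its reduction
`μ̄ ∈ Fv[X]` is monic of degree `d`, split, with roots the residues of the roots of `μ`. Lift
`g` to a monic `γ ∈ (V ∩ F)[X]`; then `γ(y) ∈ 𝔪_V` (its residue is `g(ȳ) = 0`), hence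
`γ(φ y) = φ(γ(y)) ∈ 𝔪_V` for every `φ` (`IsHenselianField.valuation_algHom_lt_one_iff`), i.e.
every root of `μ̄` is a root of `g`; so `μ̄ = g^j` (`exists_eq_pow_of_forall_mem_roots`).
(The residue-field half of ZS VI §12, Thm. 25, without ramification groups.) [folklore] -/
theorem natDegree_minpoly_residue_dvd (hF : IsHenselianField F (V.comap (algebraMap F Ω)))
    {y : Ω} (hyV : y ∈ V) (hint : IsIntegral F y) :
    (minpoly (residueSubfield F V) (residue V ⟨y, hyV⟩)).natDegree ∣ (minpoly F y).natDegree := by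
  set kF : Subfield (ResidueField V) := residueSubfield F V with hkF
  set ybar : ResidueField V := residue V ⟨y, hyV⟩ with hybar
  set μ : F[X] := minpoly F y with hμ
  have hμm : μ.Monic := minpoly.monic hint
  set μΩ : Polynomial Ω := μ.map (algebraMap F Ω) with hμΩ
  have hμΩm : μΩ.Monic := hμm.map _
  have hμΩs : μΩ.Splits := IsAlgClosed.splits _
  -- (1) every root of `μ` is a conjugate `φ(y)`, hence lies in `V`
  haveI : FiniteDimensional F F⟮y⟯ := IntermediateField.adjoin.finiteDimensional hint
  have hroot : ∀ r ∈ μΩ.roots, ∃ φ : F⟮y⟯ →ₐ[F] Ω,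
      φ (IntermediateField.AdjoinSimple.gen F y) = r := fun r hr =>
    ⟨(IntermediateField.algHomAdjoinIntegralEquiv F hint).symm ⟨r, hr⟩,
      IntermediateField.algHomAdjoinIntegralEquiv_symm_apply_gen F hint ⟨r, hr⟩⟩
  have hrV : ∀ r ∈ μΩ.roots, r ∈ V := by
    intro r hr
    obtain ⟨φ, hφ⟩ := hroot r hr
    rw [← hφ, hF.mem_iff_of_algHom V φ]
    exact hyV
  -- (2) `μ` over `V`: monic, split
  have hlift : μΩ ∈ Polynomial.lifts (algebraMap V Ω) :=
    hμΩs.mem_lift_of_roots_mem_range hμΩm (algebraMap V Ω) fun r hr => ⟨⟨r, hrV r hr⟩, rfl⟩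
  obtain ⟨μV, hμV, hμVdeg, hμVm⟩ := lifts_and_degree_eq_and_monic hlift hμΩm
  have hμVs : μV.Splits := by
    refine Splits.of_splits_map_of_injective (i := algebraMap V Ω) (IsFractionRing.injective V Ω)
      (hμV.symm ▸ hμΩs) fun r hr => ?_
    rw [hμV] at hr
    exact ⟨⟨r, hrV r hr⟩, rfl⟩
  have hμVroots : μV.roots.map (algebraMap V Ω) = μΩ.roots := by
    rw [← hμVs.roots_map_of_injective (IsFractionRing.injective V Ω), hμV]
  -- (3) the reduction `μ̄`: monic, split, coefficients in `Fv`; descend it to `P₀ ∈ Fv[X]`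
  have hμks : (μV.map (residue V)).Splits := hμVs.map _
  have hμkroots : (μV.map (residue V)).roots = μV.roots.map (residue V) :=
    hμVs.roots_map_of_ne_zero (hμVm.map _).ne_zero
  have hcoef : ∀ i, (μV.map (residue V)).coeff i ∈ Set.range (algebraMap kF (ResidueField V)) := by
    intro i
    rw [coeff_map]
    have h1 : ((μV.coeff i : V) : Ω) = algebraMap F Ω (μ.coeff i) := by
      have := congrArg (fun P : Polynomial Ω => P.coeff i) hμV
      rw [hμΩ, coeff_map, coeff_map] at this
      exact this
    have hmem : residue V (μV.coeff i) ∈ kF := by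
      refine (mem_residueSubfield_iff F V _).mpr ⟨μ.coeff i, h1 ▸ (μV.coeff i).2, ?_⟩
      congr 1
      exact Subtype.ext h1.symm
    exact ⟨⟨_, hmem⟩, rfl⟩
  obtain ⟨P₀, hP₀, hP₀deg, hP₀m⟩ :=
    lifts_and_degree_eq_and_monic ((lifts_iff_coeff_lifts _).mpr hcoef) (hμVm.map _)
  -- (4) `ȳ` is a root of `P₀`; its minimal polynomial `g`
  have hevaly : μV.eval ⟨y, hyV⟩ = 0 := by
    apply Subtype.coe_injective
    change ((μV.eval ⟨y, hyV⟩ : V) : Ω) = 0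
    rw [algebraMap_eval, hμV, hμΩ, eval_map, ← aeval_def]
    exact minpoly.aeval F y
  have hP₀y : aeval ybar P₀ = 0 := by
    rw [aeval_def, ← eval_map, hP₀, hybar, ← residue_eval, hevaly, map_zero]
  have hyint : IsIntegral kF ybar := ⟨P₀, hP₀m, hP₀y⟩
  set g : kF[X] := minpoly kF ybar with hg
  -- (5) lift `g` to a monic `γ₀` over `V ∩ F`
  let VF : ValuationSubring F := V.comap (algebraMap F Ω)
  let ι : VF →+* V := comapSubringHom F V
  let θ : VF →+* ResidueField V := (residue V).comp ι
  have hθ : ∀ c ∈ kF, c ∈ Set.range θ := by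
    intro c hc
    obtain ⟨a, ha, rfl⟩ := (mem_residueSubfield_iff F V c).mp hc
    exact ⟨⟨a, ha⟩, rfl⟩
  have hglifts : g.map (algebraMap kF (ResidueField V)) ∈ lifts θ :=
    (lifts_iff_coeff_lifts _).mpr fun i => by
      rw [coeff_map]
      exact hθ _ (g.coeff i).2
  obtain ⟨γ₀, hγ₀, -, -⟩ := lifts_and_degree_eq_and_monic hglifts ((minpoly.monic hyint).map _)
  set γV : V[X] := γ₀.map ι with hγV
  set γF : F[X] := γ₀.map (algebraMap VF F) with hγF
  have hcomp : (algebraMap F Ω).comp (algebraMap VF F) = (algebraMap V Ω).comp ι :=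
    RingHom.ext fun _ => rfl
  have hevalF : ∀ w : V, aeval (w : Ω) γF = ((γV.eval w : V) : Ω) := by
    intro w
    rw [aeval_def, hγF, eval₂_map, hcomp, ← eval₂_map, ← eval_map, hγV, ← algebraMap_eval]
  have hres : ∀ w : V, residue V (γV.eval w) = aeval (residue V w) g := by
    intro w
    rw [residue_eval, hγV, Polynomial.map_map]
    change (γ₀.map θ).eval _ = _
    rw [hγ₀, aeval_def, eval_map]
  -- (6) `γ(y) ∈ 𝔪`, hence `γ(φ y) ∈ 𝔪` for every conjugate: every root of `μ̄` is a root of `g`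
  have hy1 : V.valuation (aeval y γF) < 1 := by
    have : aeval y γF = ((γV.eval ⟨y, hyV⟩ : V) : Ω) := hevalF ⟨y, hyV⟩
    rw [this, ← ValuationSubring.valuation_lt_one_iff, ← residue_eq_zero_iff, hres, ← hybar]
    exact minpoly.aeval kF ybar
  have hrootg : ∀ w : V, (w : Ω) ∈ μΩ.roots → aeval (residue V w) g = 0 := by
    intro w hw
    obtain ⟨φ, hφ⟩ := hroot w hw
    have h1 : V.valuation (aeval (w : Ω) γF) < 1 := by
      rw [← hφ, aeval_algHom_apply, hF.valuation_algHom_lt_one_iff V φ, ← aeval_algebraMap_apply]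
      exact hy1
    rw [hevalF w, ← ValuationSubring.valuation_lt_one_iff, ← residue_eq_zero_iff, hres] at h1
    exact h1
  -- (7) `P₀ = g^j`
  have hP₀s : (P₀.map (algebraMap kF (ResidueField V))).Splits := by
    rw [hP₀]
    exact hμks
  have hall : ∀ a ∈ (P₀.map (algebraMap kF (ResidueField V))).roots, aeval a g = 0 := by
    intro a ha
    rw [hP₀, hμkroots] at ha
    obtain ⟨w, hw, rfl⟩ := Multiset.mem_map.mp ha
    refine hrootg w ?_
    rw [← hμVroots]
    exact Multiset.mem_map_of_mem _ hw
  obtain ⟨j, hj⟩ := exists_eq_pow_of_forall_mem_roots (minpoly.irreducible hyint)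
    (minpoly.monic hyint) _ P₀ rfl hP₀m hP₀s hall
  -- (8) degrees
  have hdegP₀ : P₀.natDegree = μ.natDegree := by
    have h1 : P₀.natDegree = (μV.map (residue V)).natDegree := by
      rw [← hP₀, (hP₀m).natDegree_map]
    have h2 : (μV.map (residue V)).natDegree = μV.natDegree := hμVm.natDegree_map _
    have h3 : μV.natDegree = μΩ.natDegree := natDegree_eq_of_degree_eq hμVdeg
    have h4 : μΩ.natDegree = μ.natDegree := natDegree_map _
    rw [h1, h2, h3, h4]
  rw [← hdegP₀, hj, natDegree_pow]
  exact Dvd.intro_left _ rfl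

variable {S : Subfield Ω}

omit [IsAlgClosed Ω] in
/-- `f(S|F) = [Sv : Fv]` with both residue fields computed inside the residue field of `V`
(as the subfields `residueSubfield F V ≤ residueSubfield S V`, the latter an algebra over the
former by inclusion). [folklore] -/
theorem relInertiaDegree_eq_finrank_residueSubfield (h : F ≤ S)
    (hle : residueSubfield F V ≤ residueSubfield S V) :
    letI : Algebra (residueSubfield F V) (residueSubfield S V) := (Subfield.inclusion hle).toAlgebra
    relInertiaDegree V F S h = Module.finrank (residueSubfield F V) (residueSubfield S V) := by
  letI : Algebra F S := (Subfield.inclusion h).toAlgebra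
  haveI : IsScalarTower F S Ω := IsScalarTower.of_algebraMap_eq fun _ => rfl
  unfold relInertiaDegree inertiaDegree
  exact finrank_eq_finrank_of_map_eq (residueFieldHom S V)
    (residueSubfield F (V.comap (algebraMap S Ω))) (map_residueSubfield F S V)
    (fieldRange_residueFieldHom S V) hle

omit [IsAlgClosed Ω] in
/-- For `S ≥ F` finite and `c ∈ S`, `deg_F(c) ∣ [S : F]`. [folklore] -/
theorem natDegree_minpoly_dvd_relFinrank (h : F ≤ S) (hfin : RelFinite F S h) (c : S) :
    (minpoly F (c : Ω)).natDegree ∣ relFinrank F S h := by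
  letI : Algebra F S := (Subfield.inclusion h).toAlgebra
  haveI : IsScalarTower F S Ω := IsScalarTower.of_algebraMap_eq fun _ => rfl
  haveI : FiniteDimensional F S := hfin
  change (minpoly F (algebraMap S Ω c)).natDegree ∣ _
  rw [minpoly.algebraMap_eq (algebraMap S Ω).injective c,
    ← IntermediateField.adjoin.finrank (Algebra.IsIntegral.isIntegral (R := F) c)]
  exact Dvd.intro _ (Module.finrank_mul_finrank F F⟮c⟯ S)

/-- **Prime divisors of `f(S|F)` divide `[S : F]`** for `F` henselian and `S ≥ F` finite:
`f(S|F) = [Sv : Fv]` (computed inside the residue field of `V`), every element `c̄` of `Sv`,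
`c ∈ V ∩ S`, has degree over `Fv` dividing `[F(c) : F] ∣ [S : F]`
(`natDegree_minpoly_residue_dvd`), and `prime_dvd_of_dvd_finrank_of_natDegree_minpoly_dvd`
concludes. [folklore] -/
theorem dvd_relFinrank_of_prime_dvd_relInertiaDegree (h : F ≤ S)
    (hF : IsHenselianField F (V.comap (algebraMap F Ω))) (hfin : RelFinite F S h)
    {q : ℕ} (hq : q.Prime) (hdvd : q ∣ relInertiaDegree V F S h) : q ∣ relFinrank F S h := by
  letI : Algebra F S := (Subfield.inclusion h).toAlgebra
  haveI : IsScalarTower F S Ω := IsScalarTower.of_algebraMap_eq fun _ => rfl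
  haveI : FiniteDimensional F S := hfin
  have hle : residueSubfield F V ≤ residueSubfield S V := residueSubfield_le_residueSubfield F S V
  letI : Algebra (residueSubfield F V) (residueSubfield S V) := (Subfield.inclusion hle).toAlgebra
  haveI : IsScalarTower (residueSubfield F V) (residueSubfield S V) (ResidueField V) :=
    isScalarTower_inclusion hle
  have hf := relInertiaDegree_eq_finrank_residueSubfield V h hle
  have hfpos : 0 < relInertiaDegree V F S h :=
    (one_le_relRamificationIndex_and_relInertiaDegree (V := V) h hfin).2
  haveI : FiniteDimensional (residueSubfield F V) (residueSubfield S V) :=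
    Module.finite_of_finrank_pos (hf ▸ hfpos)
  rw [hf] at hdvd
  refine prime_dvd_of_dvd_finrank_of_natDegree_minpoly_dvd (A := residueSubfield F V)
    (E := residueSubfield S V) hq (fun x => ?_) hdvd
  -- every residue has degree dividing `[S : F]`
  obtain ⟨c, hcV, hc⟩ := (mem_residueSubfield_iff S V (x : ResidueField V)).mp x.2
  have hx : minpoly (residueSubfield F V) x = minpoly (residueSubfield F V) (x : ResidueField V) :=
    (minpoly.algebraMap_eq (algebraMap (residueSubfield S V) (ResidueField V)).injective x).symm
  rw [hx, ← hc]
  have hcint : IsIntegral F (algebraMap S Ω c) :=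
    (Algebra.IsIntegral.isIntegral (R := F) c).map (IsScalarTower.toAlgHom F S Ω)
  exact (natDegree_minpoly_residue_dvd V hF hcV hcint).trans
    (natDegree_minpoly_dvd_relFinrank h hfin c)

/-- **Prime divisors of `e(S|F)·f(S|F)` divide `[S : F]`** (`F` henselian, `S ≥ F` finite inside
the algebraically closed valued field `(Ω, V)`). [folklore] -/
theorem dvd_relFinrank_of_prime_dvd (h : F ≤ S)
    (hF : IsHenselianField F (V.comap (algebraMap F Ω))) (hfin : RelFinite F S h)
    {q : ℕ} (hq : q.Prime) (hdvd : q ∣ relRamificationIndex V F S h * relInertiaDegree V F S h) :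
    q ∣ relFinrank F S h :=
  ((Nat.Prime.dvd_mul hq).mp hdvd).elim
    (dvd_relFinrank_of_prime_dvd_relRamificationIndex V h hF hfin hq)
    (dvd_relFinrank_of_prime_dvd_relInertiaDegree V h hF hfin hq)

end Residue

end Literature.AlgebraicGeometry.Resolution
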